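import Summits.HubbardSuperconductivity.HubbardLadder.PairCorrSectorAssembly
import Summits.HubbardSuperconductivity.HubbardLadder.HubbardDopedTPrimeSectorGlue
import Literature.MathematicalPhysics.QuantumLattice.PairChirality
import HarnessLib

/-!
# Rung R3 — `(N↑, N↓)`-neutrality of the `pair_dd` objectives and the ALL-`S^z` ONE-SIDED edges of the
# `pairrows1-min` half-rows (`4 × 4` torus, `t = 1`, `U = 8`, `N = 14`, `t' ∈ {-1/4, 0}`), keyed BY NAME to the
# in-tree energy nodes `Bounds.torusTTUpper_tup_4x4_U8_N14_tpm1o4` / `Bounds.torusUpper_mbbootE2_4x4_U8_N14`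

HONEST FRAMING (page 1): ladder R1–R4 with certified numbers; no claim on H/H₀.

HONEST LABEL: PROVED IMPLICATIONS ONLY — no claim node, no number, nothing instantiated, nothing run (2026-08-21).
This file is the Lean half of gate G2 of LEAD LINE (HH)/(HH′)/(HH″) (instance `pairrows1-min`, cases PDDup /
PDDlo at `r = (2,2)`): it closes the one gap between the typed consumers of record and the ROW TEXT of (HH)
("`16·P̄_d(4,(2,2)) ∈ [lo, hi]` for EVERY `N = 14` ground state of `hubbardTorusTT' 4 1 t' 8`, ALL `S^z`").

§1. NEUTRALITY. `O_r = pairCorrOp L r = Σ_x Δ_x† Δ_{x+r}` has `(N↑, N↓)`-grade `(0,0)` (each `Δ_x` has grade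
`(-1,-1)`, `PairChirality.shifts_localPair`), hence `O_r`, `V_r = pairCorrSym L r = ½(O_r + O_rᴴ)` and every list
objective `Σᵢ λᵢ V_{rᵢ} = pairListObjective L λ r` PRESERVE SECTORS (`preservesSectors_pairCorrOp/Sym/ListObjective`)
— the hypothesis `hX` of the R2 device D27/D31 all-`S^z` edges (`re_expect_ge/le_of_sectorObsCertsTT'`,
`re_expect_ge/le_of_sectorObsCerts_four_N14_U8`), which until now was available only for `𝓢`, `𝐃`, `O_χ`.

§2. ONE-SIDED EDGES, `t' = -1/4` (energy constant `u₄ = -6757592964053/2³⁹` of `torusTTUpper_tup_4x4_U8_N14_tpm1o4`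
VERBATIM, exactly as in #116 `pairCorrWindowCert_4x4_U8_N14_tpm1o4_of_certs` and D31): a family (one for every `M`)
of sector-mode certificates for the single-entry list objective with coefficient `-1` (certsdp/1
`objective_extra {"pair_dd": [{"r": r, "coeff": "-1"}]}`, typed `pairListObjective 4 (fun _ => -1) (fun _ => r)`)
and value `q` gives `16 · P̄_d(4, r; ψ) ≤ -q` for EVERY normalised `14`-particle ground state `ψ`
(`sixteen_mul_avgPairCorr_le_of_sectorObsCerts_four_N14_U8_tpm1o4`); coefficient `+1` gives `q ≤ 16 · P̄_d(4, r; ψ)`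
(`…_ge_…`). §3. The same at `t' = 0` with `u₈ = -815606355579/2³⁶` of `torusUpper_mbbootE2_4x4_U8_N14` and the
producer's physical `H = hamiltonian (fermionTorusGraph 2 4) 1 8` (`= hubbardTorusTT' 4 1 0 8`, `hubbardTorusTT'_zero`).

The `S^z = 0`-sector, two-sided object-level consumers are unchanged and in tree: `PairCorrWindowCert.ofSectorPairCerts`,
`pairCorrWindowCert_4x4_U8_N14_tpm1o4_of_certs` (#116), `pairCorrWindowCert_4x4_U8_N14_tp0_of_mbbootE2`,
`r3DichotomyFour_of_sectorPairCerts` (#117). A one-sided (PDDup-only) harvest feeds §2/§3 here and the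
`S^z`-sector edge `TorusSectorObsCertTT'.re_expect_ge` directly; it does NOT feed `PairCorrWindowCert` (two-sided by
construction) — by design of (HH″) no dichotomy statement is attempted from one-sided rows.

References: certificate TYPE and kernel edge — Wang et al. (2024) §3 eq. (obsopt), Han (2020) §2; the grading /
sector structure — Lieb, PRL 62 (1989) 1201 (proof of Thm 1), Tasaki (2020) §9.3; `P̄_d` — Qin et al., PRX 10
(2020) 031016 §II eqs. (2)–(4).
-/

noncomputable section

namespace Summit.HubbardSuperconductivity.HubbardLadder

open Matrix Literature.MathematicalPhysics.QuantumLattice Literature.Probability.LatticeModels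
open Finset hiding expect
open Bounds
open scoped ComplexOrder

/-! ## §1 The `pair_dd` objectives preserve the `(N↑, N↓)` sectors -/

section Neutral

variable (L : ℕ) [NeZero L]

/-- `O_r = Σ_x Δ_x† Δ_{x+r}` has grade `(0, 0)`: `Δ_x†` has grade `(1, 1)` and `Δ_{x+r}` grade `(-1, -1)`.
[cite: Tasaki2020, §9.3] -/
theorem shifts_pairCorrOp (r : Site 2) : PairChirality.Shifts 0 0 (pairCorrOp L r) := by
  unfold pairCorrOp
  refine PairChirality.Shifts.sum fun x _ => ?_
  have h := (PairChirality.shifts_localPair L dWaveFormFactor x).conjTranspose.mul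
    (PairChirality.shifts_localPair L dWaveFormFactor (x + Torus.proj L r))
  simp only [Int.reduceNeg, neg_neg, add_neg_cancel] at h
  exact h

/-- `O_r` conserves `N↑` and `N↓`. [cite: LiebPRL1989, Remark (2)] -/
theorem preservesSectors_pairCorrOp (r : Site 2) : PreservesSectors (pairCorrOp L r) :=
  (shifts_pairCorrOp L r).preservesSectors

/-- `V_r = ½ (O_r + O_rᴴ)` conserves `N↑` and `N↓`. [cite: LiebPRL1989, Remark (2)] -/
theorem preservesSectors_pairCorrSym (r : Site 2) : PreservesSectors (pairCorrSym L r) := by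
  have h := shifts_pairCorrOp L r
  have h' : PairChirality.Shifts 0 0 (pairCorrOp L r)ᴴ := by simpa using h.conjTranspose
  exact ((h.add h').smul _).preservesSectors

/-- Every `pair_dd` list objective `Σᵢ λᵢ V_{rᵢ}` conserves `N↑` and `N↓`. [cite: LiebPRL1989, Remark (2)] -/
theorem preservesSectors_pairListObjective {n : ℕ} (lam : Fin n → ℝ) (r : Fin n → Site 2) :
    PreservesSectors (pairListObjective L lam r) :=
  PreservesSectors.sum fun i _ => (preservesSectors_pairCorrSym L (r i)).smul _

end Neutral

/-! ## §2 All-`S^z` one-sided edges at `t' = -1/4` (`4 × 4`, `U = 8`, `N = 14`; `u₄` verbatim) -/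

section TPrimeQuarter

/-- The two spellings of `t' = -1/4` in the tree (#116 `pairCorrWindowCert_4x4_U8_N14_tpm1o4_of_certs`:
`((-1 : ℝ) / 4)`; D31/D32 nodes and edges: `(-1/4)`) are the same term (`rfl`), so a certificate term of either
spelling feeds both consumer families. [folklore] -/
theorem hubbardTorusTT'_four_tpm1o4_spellings :
    hubbardTorusTT' 4 1 ((-1 : ℝ) / 4) 8 = hubbardTorusTT' 4 1 (-1/4) 8 := rfl

/-- **UPPER half-row (PDDup, coefficient `-1`), every ground state, all `S^z`.** A family of sector-mode
certificates (one for every `M`; a certsdp/1 sector file with the `N̂ - 14` ideal only IS one for every `M`) for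
`pairListObjective 4 (fun _ => -1) (fun _ => r)` with energy constant `u₄ = -6757592964053/2³⁹` and value `q`, plus
the node `torusTTUpper_tup_4x4_U8_N14_tpm1o4`, give `16 · P̄_d(4, r; ψ) ≤ -q` for EVERY normalised `14`-particle
ground state `ψ` of `hubbardTorusTT' 4 1 (-1/4) 8`. No number: no such certificate exists (2026-08-21).
HONEST FRAMING: ladder R1–R4 with certified numbers; no claim on H/H₀. [cite: WangEtAl2024, §3 eq. (obsopt)]
[cite: QinEtAl2020, §II eqs. (2)–(4)] -/
theorem sixteen_mul_avgPairCorr_le_of_sectorObsCerts_four_N14_U8_tpm1o4 (r : Site 2) {q : ℝ}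
    (hC : ∀ M : ℝ, Nonempty (TorusSectorObsCertTT' 4 1 (-1/4) 8 14 M ((-6757592964053 : ℝ) / 2 ^ 39)
      (pairListObjective 4 (fun _ : Fin 1 => (-1 : ℝ)) (fun _ => r)) q))
    (h : torusTTUpper_tup_4x4_U8_N14_tpm1o4) {ψ : Fock (Orb (FermionTorus 2 4))}
    (hψ : IsGroundState (hubbardTorusTT' 4 1 (-1/4) 8) 14 ψ) (hψ1 : star ψ ⬝ᵥ ψ = 1) :
    16 * avgPairCorr 4 r ψ ≤ -q := by
  have h1 := re_expect_ge_of_sectorObsCertsTT' (groundEnergy_hubbardTorusTT'_four_N14_U8_tpm1o4_le_of_claim h)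
    (preservesSectors_pairListObjective 4 _ _) hC hψ hψ1
  rw [expect, re_expect_pairListObjective_single 3, ← sq_mul_avgPairCorr 3] at h1
  norm_num at h1
  linarith

/-- **LOWER half-row (PDDlo, coefficient `+1`), every ground state, all `S^z`**: `q ≤ 16 · P̄_d(4, r; ψ)`.
HONEST FRAMING: ladder R1–R4 with certified numbers; no claim on H/H₀. [cite: WangEtAl2024, §3 eq. (obsopt)]
[cite: QinEtAl2020, §II eqs. (2)–(4)] -/
theorem sixteen_mul_avgPairCorr_ge_of_sectorObsCerts_four_N14_U8_tpm1o4 (r : Site 2) {q : ℝ}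
    (hC : ∀ M : ℝ, Nonempty (TorusSectorObsCertTT' 4 1 (-1/4) 8 14 M ((-6757592964053 : ℝ) / 2 ^ 39)
      (pairListObjective 4 (fun _ : Fin 1 => (1 : ℝ)) (fun _ => r)) q))
    (h : torusTTUpper_tup_4x4_U8_N14_tpm1o4) {ψ : Fock (Orb (FermionTorus 2 4))}
    (hψ : IsGroundState (hubbardTorusTT' 4 1 (-1/4) 8) 14 ψ) (hψ1 : star ψ ⬝ᵥ ψ = 1) :
    q ≤ 16 * avgPairCorr 4 r ψ := by
  have h1 := re_expect_ge_of_sectorObsCertsTT' (groundEnergy_hubbardTorusTT'_four_N14_U8_tpm1o4_le_of_claim h)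
    (preservesSectors_pairListObjective 4 _ _) hC hψ hψ1
  rw [expect, re_expect_pairListObjective_single 3, ← sq_mul_avgPairCorr 3] at h1
  norm_num at h1
  linarith

/-- **`S^z = 0`-SECTOR reading of the UPPER half-row from ONE certificate (`M = 0`)** — the reading the #116
object-level consumers use: `16 · P̄_d(4, r; ψ) ≤ -q` for every unit ground state `ψ` of the joint sector
`(14, S^z = 0)`; energy hypothesis discharged by the node via Lieb's `E_14 = min over S^z = 0`
(`minEnergyOn_szSector_le_of_groundEnergy_rect_le`). HONEST FRAMING: ladder R1–R4 with certified numbers; no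
claim on H/H₀. [cite: WangEtAl2024, §3 eq. (obsopt)] [cite: LiebPRL1989] -/
theorem sixteen_mul_avgPairCorr_le_of_sectorObsCert_sz0_four_N14_U8_tpm1o4 (r : Site 2) {q : ℝ}
    (C : TorusSectorObsCertTT' 4 1 (-1/4) 8 14 0 ((-6757592964053 : ℝ) / 2 ^ 39)
      (pairListObjective 4 (fun _ : Fin 1 => (-1 : ℝ)) (fun _ => r)) q)
    (h : torusTTUpper_tup_4x4_U8_N14_tpm1o4) (ψ : Fock (Orb (FermionTorus 2 4))) (hψ1 : star ψ ⬝ᵥ ψ = 1)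
    (hgs : IsGroundStateInSector (hubbardTorusTT' 4 1 (-1/4) 8) 14 0 ψ) :
    16 * avgPairCorr 4 r ψ ≤ -q := by
  have hn : 7 ≤ Fintype.card (FermionTorus 2 4) := by simp [FermionTorus, Fintype.card_pi]
  have hE : (hubbardTorusTT' 4 1 (-1/4) 8).minEnergyOn (szSector 14 0) ≤ (-6757592964053 : ℝ) / 2 ^ 39 :=
    minEnergyOn_szSector_le_of_groundEnergy_rect_le (L := 4) 1 (-1/4) 8 (nh := 7) hn
      (groundEnergy_tt_4x4_U8_N14_tpm1o4_le_of_claim h)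
  have h1 := C.re_expect_ge hE ψ hψ1 hgs
  rw [re_expect_pairListObjective_single 3, ← sq_mul_avgPairCorr 3] at h1
  norm_num at h1
  linarith

end TPrimeQuarter

/-! ## §3 All-`S^z` one-sided edges at `t' = 0` (`4 × 4`, `U = 8`, `N = 14`; `u₈` verbatim) -/

section TPrimeZero

/-- **UPPER half-row at `t' = 0` (PDDup, coefficient `-1`), every ground state, all `S^z`**: certificates written
against `hubbardTorusTT' 4 1 0 8` with `u₈ = -815606355579/2³⁶`, plus the inherited node
`torusUpper_mbbootE2_4x4_U8_N14`, give `16 · P̄_d(4, r; ψ) ≤ -q` for every normalised `14`-particle ground state of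
`hamiltonian (fermionTorusGraph 2 4) 1 8`. HONEST FRAMING: ladder R1–R4 with certified numbers; no claim on H/H₀.
[cite: WangEtAl2024, §3 eq. (obsopt)] [cite: QinEtAl2020, §II eqs. (2)–(4)] -/
theorem sixteen_mul_avgPairCorr_le_of_sectorObsCerts_four_N14_U8_tp0 (r : Site 2) {q : ℝ}
    (hC : ∀ M : ℝ, Nonempty (TorusSectorObsCertTT' 4 1 0 8 14 M ((-815606355579 : ℝ) / 2 ^ 36)
      (pairListObjective 4 (fun _ : Fin 1 => (-1 : ℝ)) (fun _ => r)) q))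
    (h₈ : torusUpper_mbbootE2_4x4_U8_N14) {ψ : Fock (Orb (FermionTorus 2 4))}
    (hψ : IsGroundState (hamiltonian (fermionTorusGraph 2 4) 1 8) 14 ψ) (hψ1 : star ψ ⬝ᵥ ψ = 1) :
    16 * avgPairCorr 4 r ψ ≤ -q := by
  have h1 := re_expect_ge_of_sectorObsCerts_four_N14_U8 (preservesSectors_pairListObjective 4 _ _) hC hψ hψ1 h₈
  rw [expect, re_expect_pairListObjective_single 3, ← sq_mul_avgPairCorr 3] at h1
  norm_num at h1
  linarith

/-- **LOWER half-row at `t' = 0` (PDDlo, coefficient `+1`)**: `q ≤ 16 · P̄_d(4, r; ψ)` for every normalised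
`14`-particle ground state. HONEST FRAMING: ladder R1–R4 with certified numbers; no claim on H/H₀.
[cite: WangEtAl2024, §3 eq. (obsopt)] [cite: QinEtAl2020, §II eqs. (2)–(4)] -/
theorem sixteen_mul_avgPairCorr_ge_of_sectorObsCerts_four_N14_U8_tp0 (r : Site 2) {q : ℝ}
    (hC : ∀ M : ℝ, Nonempty (TorusSectorObsCertTT' 4 1 0 8 14 M ((-815606355579 : ℝ) / 2 ^ 36)
      (pairListObjective 4 (fun _ : Fin 1 => (1 : ℝ)) (fun _ => r)) q))
    (h₈ : torusUpper_mbbootE2_4x4_U8_N14) {ψ : Fock (Orb (FermionTorus 2 4))}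
    (hψ : IsGroundState (hamiltonian (fermionTorusGraph 2 4) 1 8) 14 ψ) (hψ1 : star ψ ⬝ᵥ ψ = 1) :
    q ≤ 16 * avgPairCorr 4 r ψ := by
  have h1 := re_expect_ge_of_sectorObsCerts_four_N14_U8 (preservesSectors_pairListObjective 4 _ _) hC hψ hψ1 h₈
  rw [expect, re_expect_pairListObjective_single 3, ← sq_mul_avgPairCorr 3] at h1
  norm_num at h1
  linarith

end TPrimeZero

end Summit.HubbardSuperconductivity.HubbardLadder
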